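import Summits.AtomisticToContinuum.FouriersLaw.Theorems.BondHeatUncertaintySubdiffusiveBondHeatJunctionLawCalibration

/-!
# Graded one-good-scale kernel: `BufferedJunctionLawPow θ ∧ EscapeInfZeroPow θ ⟹ 11071` for `0 ≤ θ < 1` — same exponent, liminf floor

Support file for stmt-AtomisticToContinuum-11071 (`BondHeatUncertainty.BoundedResponse`), decomposition cell `decomp-a2c`, lens-1 (grading /
quantitative ladder), gen 57 — file (11) (imports (10)).

The tree's graded node `SplitLaw θ ∧ ExponentFloor s ⟹ 11071` (balanced splits, `…JunctionSplitLaw`) needs a floor exponent STRICTLY above the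
defect exponent (`s > θ`) holding for ALL large `N`.  For the FREE-split laws the grading is sharper on both counts: with junction defect
`C·N^θ` (`BufferedJunctionLawPow θ`; `θ = 0` is file (5)'s `BufferedJunctionLaw`, `L₀ = 0` is file (2)'s `JunctionLaw θ`) it suffices that at ONE
large scale `N⋆` the resistance beats the accumulated defect of a doubling chain, `1/E_{N⋆} ≥ K_θ·C·(N⋆+L₀)^θ + c`
(`K_θ = ρ/(1−ρ)`, `ρ = 2^{θ−1}`;
`K_0 = 1` recovers file (9)), and such a scale exists as soon as `liminf_N N^θ·E_N(T) = 0` — the SAME exponent `θ`, as a LIMINF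
(`EscapeInfZeroPow θ`; `θ = 0` is (9)'s `EscapeInfZero` ≡ stmt-9127).  Mechanism: doubling chain `N_{j+1} = 2N_j + L₀` from `N_0 = N⋆`
(`r(N_j)/2^j ≥ r(N⋆) − C(N⋆+L₀)^θ Σ_{i≤j} ρ^i`), then free splits fill in every `N` between consecutive `N_j` at cost `C·N^θ = o(N)`.

Contents: abstract kernel `linear_of_bufferedJunctionPow_of_goodScale`; per-temperature `escapeFloor_one_of_bufferedJunctionPowAt_of_goodScale`;
Props `BufferedJunctionLawPow θ`, `EscapeInfZeroPow θ` with `…_zero_iff` (recovering (5)/(9)), monotonicity, `JunctionLaw θ → BufferedJunctionLawPow θ`;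
feeders `ExponentFloor s → EscapeInfZeroPow θ` (`θ < s`), `CurrentCorrectorBudget a → EscapeInfZeroPow θ` (`θ < (3−a)/2`); NODE
`boundedResponse_of_bufferedJunctionLawPow_of_escapeInfZeroPow` (`0 ≤ θ < 1`) and `boundedResponse_of_junctionLaw_of_escapeInfZeroPow`.
Ladder reading: the junction defect may grow like `N^θ` for any `θ < 1` provided `N^θ E_N(T)` dips to `0` along SOME subsequence.
No `sorry`; standard axioms; nothing here closes an item.
-/

noncomputable section

open MeasureTheory Filter Topology Set
open scoped BigOperators

namespace Summit.AtomisticToContinuum.FouriersLaw.Theorems.SubdiffusiveBondHeat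

namespace EscapeGrading

open Literature.MathematicalPhysics.KineticTheory.HeatConduction
open Summit.AtomisticToContinuum.FouriersLaw.Theses.BondHeatUncertainty (BoundedResponse NonBallistic)

/-! ## Elementary tools -/

/-- `(2^n)^θ = (2^θ)^n`. [folklore] -/
theorem two_pow_rpow_comm (n : ℕ) (θ : ℝ) : ((2 : ℝ) ^ n) ^ θ = ((2 : ℝ) ^ θ) ^ n := by
  rw [← Real.rpow_natCast 2 n, ← Real.rpow_mul (by norm_num), mul_comm, Real.rpow_mul (by norm_num), Real.rpow_natCast]

/-- Sublinearity of `N^θ`, `θ < 1`: `C·N^θ ≤ a·N` eventually, for every `a > 0`. [folklore] -/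
theorem rpow_le_linear_eventually {θ C a : ℝ} (hθ : θ < 1) (hC : 0 ≤ C) (ha : 0 < a) :
    ∃ N₁ : ℕ, ∀ N : ℕ, N₁ ≤ N → C * (N : ℝ) ^ θ ≤ a * N := by
  have ht : (0 : ℝ) < a / (C + 1) := by positivity
  have hlim : Tendsto (fun N : ℕ => ((N : ℝ)) ^ (-(1 - θ))) atTop (𝓝 0) :=
    (tendsto_rpow_neg_atTop (by linarith : 0 < 1 - θ)).comp tendsto_natCast_atTop_atTop
  obtain ⟨N₁, hN₁⟩ := eventually_atTop.1 (hlim.eventually (Iic_mem_nhds ht))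
  refine ⟨max N₁ 1, fun N hN => ?_⟩
  have hNpos : (0 : ℝ) < N := by exact_mod_cast lt_of_lt_of_le one_pos (le_trans (le_max_right N₁ 1) hN)
  have hsmall : (N : ℝ) ^ (-(1 - θ)) ≤ a / (C + 1) := hN₁ N (le_trans (le_max_left _ _) hN)
  have hsplit : (N : ℝ) ^ θ = (N : ℝ) ^ (-(1 - θ)) * N := by
    have h := Real.rpow_add hNpos (-(1 - θ)) 1
    rw [Real.rpow_one] at h
    rw [← h]
    ring_nf
  rw [hsplit, ← mul_assoc]
  refine mul_le_mul_of_nonneg_right ?_ hNpos.le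
  calc C * (N : ℝ) ^ (-(1 - θ)) ≤ C * (a / (C + 1)) := mul_le_mul_of_nonneg_left hsmall hC
    _ ≤ a := by
        rw [mul_div_assoc']
        exact (div_le_iff₀ (by positivity)).2 (by nlinarith)

/-- The doubling chain `N_0 = N⋆`, `N_{j+1} = N_j + L₀ + N_j`. [kernel] -/
def dblChain (Ns L₀ : ℕ) : ℕ → ℕ
  | 0 => Ns
  | j + 1 => dblChain Ns L₀ j + L₀ + dblChain Ns L₀ j

/-- `N_j + L₀ ≤ 2^j (N⋆ + L₀)`. [folklore] -/
theorem dblChain_add_le (Ns L₀ : ℕ) : ∀ j : ℕ, dblChain Ns L₀ j + L₀ ≤ 2 ^ j * (Ns + L₀)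
  | 0 => by simp [dblChain]
  | j + 1 => by
    have ih := dblChain_add_le Ns L₀ j
    show dblChain Ns L₀ j + L₀ + dblChain Ns L₀ j + L₀ ≤ 2 ^ (j + 1) * (Ns + L₀)
    rw [pow_succ]
    nlinarith

/-- `N⋆ ≤ N_j` and `2^j ≤ N_j` when `1 ≤ N⋆`. [folklore] -/
theorem le_dblChain (Ns L₀ : ℕ) (hNs : 1 ≤ Ns) : ∀ j : ℕ, Ns ≤ dblChain Ns L₀ j ∧ 2 ^ j ≤ dblChain Ns L₀ j
  | 0 => by simp [dblChain, hNs]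
  | j + 1 => by
    obtain ⟨h1, h2⟩ := le_dblChain Ns L₀ hNs j
    refine ⟨?_, ?_⟩
    · show Ns ≤ dblChain Ns L₀ j + L₀ + dblChain Ns L₀ j
      omega
    · show 2 ^ (j + 1) ≤ dblChain Ns L₀ j + L₀ + dblChain Ns L₀ j
      rw [pow_succ]
      omega

/-- The graded chain factor `K_θ = ρ/(1 − ρ)`, `ρ = 2^θ/2` (`K_0 = 1`). [kernel] -/
def gradedChainFactor (θ : ℝ) : ℝ := ((2 : ℝ) ^ θ / 2) / (1 - (2 : ℝ) ^ θ / 2)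

/-- `K_0 = 1`. [folklore] -/
theorem gradedChainFactor_zero : gradedChainFactor 0 = 1 := by
  simp [gradedChainFactor]
  norm_num

/-! ## The graded kernel -/

/-- **Doubling-chain minorant.**  Under `r_u + r_v − C·(u+L₀+v)^θ ≤ r_{u+L₀+v}` (`u, v ≥ N₂`, `θ ≥ 0`, `C ≥ 0`), along the
doubling chain from
`N⋆ ≥ N₂`: `2^j·(r_{N⋆} − C(N⋆+L₀)^θ·Σ_{i<j} ρ^{i+1}) ≤ r_{N_j}`, `ρ = 2^θ/2`. [kernel] -/
theorem dblChain_minorant {r : ℕ → ℝ} {θ C : ℝ} {L₀ N₂ Ns : ℕ} (hθ0 : 0 ≤ θ) (hC : 0 ≤ C)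
    (hJ : ∀ u v : ℕ, N₂ ≤ u → N₂ ≤ v → r u + r v - C * ((u + L₀ + v : ℕ) : ℝ) ^ θ ≤ r (u + L₀ + v))
    (hNs : N₂ ≤ Ns) (hNs1 : 1 ≤ Ns) :
    ∀ j : ℕ, (2 : ℝ) ^ j * (r Ns - C * ((Ns + L₀ : ℕ) : ℝ) ^ θ * ∑ i ∈ Finset.range j, ((2 : ℝ) ^ θ / 2) ^ (i + 1))
      ≤ r (dblChain Ns L₀ j)
  | 0 => by simp [dblChain]
  | j + 1 => by
    have ih := dblChain_minorant hθ0 hC hJ hNs hNs1 j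
    have hNj : N₂ ≤ dblChain Ns L₀ j := le_trans hNs (le_dblChain Ns L₀ hNs1 j).1
    have hstep := hJ (dblChain Ns L₀ j) (dblChain Ns L₀ j) hNj hNj
    have hdef : ((dblChain Ns L₀ j + L₀ + dblChain Ns L₀ j : ℕ) : ℝ) ^ θ
        ≤ ((2 : ℝ) ^ θ) ^ (j + 1) * ((Ns + L₀ : ℕ) : ℝ) ^ θ := by
      have hle : ((dblChain Ns L₀ j + L₀ + dblChain Ns L₀ j : ℕ) : ℝ) ≤ (2 : ℝ) ^ (j + 1) * ((Ns + L₀ : ℕ) : ℝ) := by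
        have h := dblChain_add_le Ns L₀ (j + 1)
        have h' : dblChain Ns L₀ (j + 1) ≤ 2 ^ (j + 1) * (Ns + L₀) := le_trans (Nat.le_add_right _ _) h
        exact_mod_cast h'
      calc ((dblChain Ns L₀ j + L₀ + dblChain Ns L₀ j : ℕ) : ℝ) ^ θ
          ≤ ((2 : ℝ) ^ (j + 1) * ((Ns + L₀ : ℕ) : ℝ)) ^ θ := Real.rpow_le_rpow (by positivity) hle hθ0
        _ = ((2 : ℝ) ^ (j + 1)) ^ θ * ((Ns + L₀ : ℕ) : ℝ) ^ θ := Real.mul_rpow (by positivity) (by positivity)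
        _ = ((2 : ℝ) ^ θ) ^ (j + 1) * ((Ns + L₀ : ℕ) : ℝ) ^ θ := by rw [two_pow_rpow_comm]
    have hpow : ((2 : ℝ) ^ θ) ^ (j + 1) = (2 : ℝ) ^ (j + 1) * ((2 : ℝ) ^ θ / 2) ^ (j + 1) := by
      rw [← mul_pow]; congr 1; ring
    rw [Finset.sum_range_succ, pow_succ]
    show 2 ^ j * 2 * (r Ns - C * ((Ns + L₀ : ℕ) : ℝ) ^ θ *
        (∑ i ∈ Finset.range j, ((2 : ℝ) ^ θ / 2) ^ (i + 1) + ((2 : ℝ) ^ θ / 2) ^ (j + 1))) ≤ r (dblChain Ns L₀ (j + 1))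
    show _ ≤ r (dblChain Ns L₀ j + L₀ + dblChain Ns L₀ j)
    have hCA : 0 ≤ C * ((Ns + L₀ : ℕ) : ℝ) ^ θ := mul_nonneg hC (Real.rpow_nonneg (by positivity) θ)
    have hdef' : C * ((dblChain Ns L₀ j + L₀ + dblChain Ns L₀ j : ℕ) : ℝ) ^ θ
        ≤ C * ((Ns + L₀ : ℕ) : ℝ) ^ θ * ((2 : ℝ) ^ (j + 1) * ((2 : ℝ) ^ θ / 2) ^ (j + 1)) := by
      rw [← hpow]
      calc C * ((dblChain Ns L₀ j + L₀ + dblChain Ns L₀ j : ℕ) : ℝ) ^ θ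
          ≤ C * (((2 : ℝ) ^ θ) ^ (j + 1) * ((Ns + L₀ : ℕ) : ℝ) ^ θ) := mul_le_mul_of_nonneg_left hdef hC
        _ = C * ((Ns + L₀ : ℕ) : ℝ) ^ θ * ((2 : ℝ) ^ θ) ^ (j + 1) := by ring
    rw [pow_succ] at hdef'
    nlinarith [ih, hstep, hdef', hCA]

/-- `Σ_{i<j} ρ^{i+1} ≤ K_θ` for `0 ≤ θ < 1` (`0 ≤ ρ = 2^θ/2 < 1`, geometric series). [folklore] -/
theorem geom_sum_le_gradedChainFactor {θ : ℝ} (hθ : θ < 1) (j : ℕ) :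
    ∑ i ∈ Finset.range j, ((2 : ℝ) ^ θ / 2) ^ (i + 1) ≤ gradedChainFactor θ := by
  have hρ0 : 0 ≤ (2 : ℝ) ^ θ / 2 := by positivity
  have hρ1 : (2 : ℝ) ^ θ / 2 < 1 := by
    have h : (2 : ℝ) ^ θ < (2 : ℝ) ^ (1 : ℝ) := Real.rpow_lt_rpow_of_exponent_lt (by norm_num) hθ
    rw [Real.rpow_one] at h
    linarith
  have hgeom : ∑ i ∈ Finset.range j, ((2 : ℝ) ^ θ / 2) ^ i ≤ (1 - (2 : ℝ) ^ θ / 2)⁻¹ :=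
    sum_le_hasSum (Finset.range j) (fun i _ => pow_nonneg hρ0 i) (hasSum_geometric_of_lt_one hρ0 hρ1)
  have hfac : ∑ i ∈ Finset.range j, ((2 : ℝ) ^ θ / 2) ^ (i + 1)
      = (2 : ℝ) ^ θ / 2 * ∑ i ∈ Finset.range j, ((2 : ℝ) ^ θ / 2) ^ i := by
    rw [Finset.mul_sum]
    refine Finset.sum_congr rfl fun i _ => ?_
    ring
  rw [hfac, gradedChainFactor, div_eq_mul_inv ((2 : ℝ) ^ θ / 2)]
  exact mul_le_mul_of_nonneg_left hgeom hρ0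

/-- **THE GRADED KERNEL — one good scale across buffers, defect `C·N^θ`, `0 ≤ θ < 1`.**  If `r ≥ 0` beyond `N₂`,
`r_u + r_v − C(u+L₀+v)^θ ≤ r_{u+L₀+v}` for `u, v ≥ N₂`, and ONE scale `N⋆ ≥ max N₂ L₀`, `N⋆ ≥ 1`, has
`K_θ·C·(N⋆+L₀)^θ + c ≤ r_{N⋆}` with `c > 0`,
then `a·N ≤ r_N` eventually, some `a > 0` (doubling chain + free-split fill-in + `N^θ = o(N)`). [kernel] -/
theorem linear_of_bufferedJunctionPow_of_goodScale {r : ℕ → ℝ} {θ C c : ℝ} {L₀ N₂ Ns : ℕ} (hθ0 : 0 ≤ θ) (hθ : θ < 1)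
    (hC : 0 ≤ C) (hc : 0 < c) (hr0 : ∀ n : ℕ, N₂ ≤ n → 0 ≤ r n)
    (hJ : ∀ u v : ℕ, N₂ ≤ u → N₂ ≤ v → r u + r v - C * ((u + L₀ + v : ℕ) : ℝ) ^ θ ≤ r (u + L₀ + v))
    (hNs : N₂ ≤ Ns) (hNs1 : 1 ≤ Ns) (hL : L₀ ≤ Ns)
    (hgood : gradedChainFactor θ * C * ((Ns + L₀ : ℕ) : ℝ) ^ θ + c ≤ r Ns) :
    ∃ a : ℝ, 0 < a ∧ ∃ N₀ : ℕ, ∀ N : ℕ, N₀ ≤ N → a * (N : ℝ) ≤ r N := by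
  -- (1) along the chain: `c·2^j ≤ r(N_j)`
  have hchain : ∀ j : ℕ, c * (2 : ℝ) ^ j ≤ r (dblChain Ns L₀ j) := by
    intro j
    have hmin := dblChain_minorant hθ0 hC hJ hNs hNs1 j
    have hS := geom_sum_le_gradedChainFactor hθ j
    have hCA : 0 ≤ C * ((Ns + L₀ : ℕ) : ℝ) ^ θ := mul_nonneg hC (Real.rpow_nonneg (by positivity) θ)
    have h1 : c ≤ r Ns - C * ((Ns + L₀ : ℕ) : ℝ) ^ θ * ∑ i ∈ Finset.range j, ((2 : ℝ) ^ θ / 2) ^ (i + 1) := by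
      have h2 := mul_le_mul_of_nonneg_left hS hCA
      nlinarith
    have h2j : (0 : ℝ) ≤ 2 ^ j := by positivity
    nlinarith
  -- (2) sublinearity budget: `C·N^θ ≤ (c/(10(N⋆+L₀)))·N` eventually
  have hP : (0 : ℝ) < ((Ns + L₀ : ℕ) : ℝ) := by exact_mod_cast (show 0 < Ns + L₀ by omega)
  obtain ⟨N₁, hN₁⟩ := rpow_le_linear_eventually hθ hC (show (0 : ℝ) < c / (10 * ((Ns + L₀ : ℕ) : ℝ)) by positivity)
  refine ⟨c / (10 * ((Ns + L₀ : ℕ) : ℝ)), by positivity, max N₁ (Ns + L₀ + N₂), fun N hN => ?_⟩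
  have hN1 : N₁ ≤ N := le_trans (le_max_left _ _) hN
  have hN0 : Ns + L₀ + N₂ ≤ N := le_trans (le_max_right _ _) hN
  -- (3) the largest chain element fitting below `N` with room for a buffer and a block `≥ N₂`
  classical
  let P : ℕ → Prop := fun j => dblChain Ns L₀ j + L₀ + N₂ ≤ N
  have hP0 : P 0 := by show dblChain Ns L₀ 0 + L₀ + N₂ ≤ N; exact hN0
  obtain ⟨j, hj⟩ : ∃ j : ℕ, j = Nat.findGreatest P N := ⟨_, rfl⟩
  have hPj : P j := by rw [hj]; exact Nat.findGreatest_spec (Nat.zero_le N) hP0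
  have hjN : j + 1 ≤ N := by
    -- `2^j ≤ N_j ≤ N` forces `j < N`
    have h2 : 2 ^ j ≤ dblChain Ns L₀ j := (le_dblChain Ns L₀ hNs1 j).2
    have h3 : dblChain Ns L₀ j ≤ N := le_trans (by omega) hPj
    have h4 : j < 2 ^ j := Nat.lt_two_pow_self
    omega
  have hnotP : ¬ P (j + 1) := Nat.findGreatest_is_greatest (by rw [hj]; exact Nat.lt_succ_self _) hjN
  have hlt : N < dblChain Ns L₀ (j + 1) + L₀ + N₂ := by
    by_contra h; exact hnotP (not_lt.1 h)
  have hlt' : N < dblChain Ns L₀ j + L₀ + dblChain Ns L₀ j + L₀ + N₂ := hlt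
  -- (4) the free split `N = N_j + L₀ + m`, `m ≥ N₂`
  obtain ⟨m, hm⟩ : ∃ m : ℕ, m = N - dblChain Ns L₀ j - L₀ := ⟨_, rfl⟩
  have hmN₂ : N₂ ≤ m := by rw [hm]; unfold P at hPj; omega
  have hNeq : dblChain Ns L₀ j + L₀ + m = N := by rw [hm]; unfold P at hPj; omega
  have hNj₂ : N₂ ≤ dblChain Ns L₀ j := le_trans hNs (le_dblChain Ns L₀ hNs1 j).1
  have hsplit := hJ (dblChain Ns L₀ j) m hNj₂ hmN₂
  rw [hNeq] at hsplit
  have hrm := hr0 m hmN₂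
  have hcj := hchain j
  -- (5) `N < 5·N_j` and `N_j + L₀ ≤ 2^j (N⋆+L₀)` ⇒ `c·2^j ≥ (c/(5(N⋆+L₀)))·N`
  have hNsj : Ns ≤ dblChain Ns L₀ j := (le_dblChain Ns L₀ hNs1 j).1
  have h5 : N < 5 * dblChain Ns L₀ j := by omega
  have h5R : (N : ℝ) < 5 * (dblChain Ns L₀ j : ℝ) := by exact_mod_cast h5
  have hDj : ((dblChain Ns L₀ j : ℕ) : ℝ) ≤ (2 : ℝ) ^ j * ((Ns + L₀ : ℕ) : ℝ) := by
    have h := le_trans (Nat.le_add_right _ L₀) (dblChain_add_le Ns L₀ j)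
    exact_mod_cast h
  have hlin : c / (5 * ((Ns + L₀ : ℕ) : ℝ)) * (N : ℝ) ≤ c * (2 : ℝ) ^ j := by
    rw [div_mul_eq_mul_div, div_le_iff₀ (by positivity)]
    have : c * (N : ℝ) ≤ c * (5 * ((2 : ℝ) ^ j * ((Ns + L₀ : ℕ) : ℝ))) := by
      refine mul_le_mul_of_nonneg_left ?_ hc.le
      nlinarith
    nlinarith
  have hbud := hN₁ N hN1
  -- (6) assemble: `r N ≥ c 2^j + r m − C N^θ ≥ (c/(5P)) N − (c/(10P)) N`
  have e : c / (10 * ((Ns + L₀ : ℕ) : ℝ)) * (N : ℝ)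
      = c / (5 * ((Ns + L₀ : ℕ) : ℝ)) * (N : ℝ) - c / (10 * ((Ns + L₀ : ℕ) : ℝ)) * (N : ℝ) := by
    ring
  rw [e]
  linarith

/-! ## The graded pieces -/

/-- **Buffered junction law with defect exponent `θ`**: `∀ T ∃ C ≥ 0, L₀, N₂: ∀ u, v ≥ N₂,
`1/E_u + 1/E_v − C·(u+L₀+v)^θ ≤ 1/E_{u+L₀+v}`.
`θ = 0` is file (5)'s `BufferedJunctionLaw`; `JunctionLaw θ ⟹` it (`L₀ = 0`).  UNDECIDED for `θ < 1`; inert for `θ ≥ 1`. [piece · rung] -/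
def BufferedJunctionLawPow (θ : ℝ) : Prop :=
  ∀ ω₂ lam β γ : ℝ, 0 < ω₂ → 0 < lam → 0 < β → 0 < γ → ∀ T : ℝ, 0 < T →
    ∃ C : ℝ, 0 ≤ C ∧ ∃ L₀ N₂ : ℕ, ∀ u v : ℕ, N₂ ≤ u → N₂ ≤ v →
      1 / escapeDeficit ω₂ lam β γ T u + 1 / escapeDeficit ω₂ lam β γ T v - C * ((u + L₀ + v : ℕ) : ℝ) ^ θ
        ≤ 1 / escapeDeficit ω₂ lam β γ T (u + L₀ + v)

/-- **Graded liminf floor**: `∀ T ∀ ε > 0`, `N^θ·E_N(T) ≤ ε` for arbitrarily large `N` (`liminf_N N^θ E_N(T) = 0`).  `θ = 0` is (9)'s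
`EscapeInfZero` ≡ stmt-9127; fed by `ExponentFloor s`, `s > θ`.  UNDECIDED for `θ ≥ 0`. [piece · rung] -/
def EscapeInfZeroPow (θ : ℝ) : Prop :=
  ∀ ω₂ lam β γ : ℝ, 0 < ω₂ → 0 < lam → 0 < β → 0 < γ → ∀ T : ℝ, 0 < T →
    ∀ ε : ℝ, 0 < ε → ∀ M : ℕ, ∃ N : ℕ, M ≤ N ∧ ((N : ℕ) : ℝ) ^ θ * escapeDeficit ω₂ lam β γ T N ≤ ε

/-- `BufferedJunctionLawPow 0 ↔ BufferedJunctionLaw`. [folklore] -/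
theorem bufferedJunctionLawPow_zero_iff : BufferedJunctionLawPow 0 ↔ JunctionDefectGrading.BufferedJunctionLaw := by
  simp only [BufferedJunctionLawPow, JunctionDefectGrading.BufferedJunctionLaw, Real.rpow_zero, mul_one]

/-- `EscapeInfZeroPow 0 ↔ EscapeInfZero` (≡ stmt-9127). [folklore] -/
theorem escapeInfZeroPow_zero_iff : EscapeInfZeroPow 0 ↔ EscapeInfZero := by
  simp only [EscapeInfZeroPow, EscapeInfZero, Real.rpow_zero, one_mul]

/-- `JunctionLaw θ ⟹ BufferedJunctionLawPow θ` (empty buffer, threshold `2`). [folklore] -/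
theorem bufferedJunctionLawPow_of_junctionLaw {θ : ℝ} (hJ : JunctionDefectGrading.JunctionLaw θ) : BufferedJunctionLawPow θ := by
  intro ω₂ lam β γ hω hl hβ hγ T hT
  obtain ⟨C, hC, h⟩ := hJ ω₂ lam β γ hω hl hβ hγ T hT
  refine ⟨C, hC, 0, 2, fun u v hu hv => ?_⟩
  have h' := h u v hu hv
  have e1 : u + 0 + v = u + v := by omega
  have e2 : ((u + 0 + v : ℕ) : ℝ) = (u : ℝ) + v := by push_cast; ring
  rw [e1] at e2 ⊢
  rw [e2]
  exact h'

/-- `ExponentFloor s ⟹ EscapeInfZeroPow θ` for `θ < s` (`N^θ·C/N^s = C·N^{−(s−θ)} → 0`). [folklore] -/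
theorem escapeInfZeroPow_of_exponentFloor {θ s : ℝ} (hθs : θ < s) (hF : ExponentFloor s) : EscapeInfZeroPow θ := by
  intro ω₂ lam β γ hω hl hβ hγ T hT ε hε M
  obtain ⟨C, N₀, hN₀⟩ := hF ω₂ lam β γ hω hl hβ hγ T hT
  have hlim : Tendsto (fun N : ℕ => max C 0 * ((N : ℝ)) ^ (-(s - θ))) atTop (𝓝 0) := by
    have h := ((tendsto_rpow_neg_atTop (by linarith : 0 < s - θ)).comp tendsto_natCast_atTop_atTop).const_mul (max C 0)
    rwa [mul_zero] at h
  obtain ⟨N₁, hN₁⟩ := eventually_atTop.1 (hlim.eventually (Iic_mem_nhds hε))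
  refine ⟨max (max N₀ N₁) (max M 1), le_trans (le_max_left M 1) (le_max_right _ _), ?_⟩
  set N := max (max N₀ N₁) (max M 1) with hN
  have hNpos : (0 : ℝ) < N := by
    exact_mod_cast lt_of_lt_of_le one_pos (le_trans (le_max_right M 1) (le_max_right _ _))
  have hE := hN₀ N (le_trans (le_max_left _ _) (le_max_left _ _))
  have hsmall : max C 0 * (N : ℝ) ^ (-(s - θ)) ≤ ε := hN₁ N (le_trans (le_max_right _ _) (le_max_left _ _))
  have hθpos : 0 < (N : ℝ) ^ θ := Real.rpow_pos_of_pos hNpos θ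
  have hspos : 0 < (N : ℝ) ^ s := Real.rpow_pos_of_pos hNpos s
  have hpow : (N : ℝ) ^ θ / (N : ℝ) ^ s = (N : ℝ) ^ (-(s - θ)) := by
    rw [← Real.rpow_sub hNpos]; ring_nf
  calc (N : ℝ) ^ θ * escapeDeficit ω₂ lam β γ T N ≤ (N : ℝ) ^ θ * (C / (N : ℝ) ^ s) :=
        mul_le_mul_of_nonneg_left hE hθpos.le
    _ ≤ (N : ℝ) ^ θ * (max C 0 / (N : ℝ) ^ s) :=
        mul_le_mul_of_nonneg_left (div_le_div_of_nonneg_right (le_max_left C 0) hspos.le) hθpos.le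
    _ = max C 0 * ((N : ℝ) ^ θ / (N : ℝ) ^ s) := by ring
    _ = max C 0 * (N : ℝ) ^ (-(s - θ)) := by rw [hpow]
    _ ≤ ε := hsmall

/-- `CurrentCorrectorBudget a ⟹ EscapeInfZeroPow θ` for `θ < (3−a)/2` (file 7c's `F((3−a)/2)`). [folklore] -/
theorem escapeInfZeroPow_of_currentCorrectorBudget {a θ : ℝ} (hθ : θ < (3 - a) / 2) (hE : CurrentCorrectorBudget a) :
    EscapeInfZeroPow θ :=
  escapeInfZeroPow_of_exponentFloor hθ (exponentFloor_of_currentCorrectorBudget hE)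

/-! ## Per temperature and the graded node -/

/-- **Per-temperature graded kernel.**  Under the `θ`-defect buffered junction inequality at `T` (`0 ≤ θ < 1`), ONE scale
`N⋆ ≥ max N₂ 2, N⋆ ≥ L₀` with `K_θ·C·(N⋆+L₀)^θ + c ≤ 1/E_{N⋆}(T)` (`c > 0`) gives `E_N(T) ≤ C₁/N` eventually. [kernel] -/
theorem escapeFloor_one_of_bufferedJunctionPowAt_of_goodScale {ω₂ lam β γ T : ℝ} (hω : 0 < ω₂) (hl : 0 < lam) (hβ : 0 < β)
    (hγ : 0 < γ) (hT : 0 < T) {θ C c : ℝ} {L₀ N₂ Ns : ℕ} (hθ0 : 0 ≤ θ) (hθ : θ < 1) (hC : 0 ≤ C) (hc : 0 < c)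
    (hJ : ∀ u v : ℕ, N₂ ≤ u → N₂ ≤ v →
      1 / escapeDeficit ω₂ lam β γ T u + 1 / escapeDeficit ω₂ lam β γ T v - C * ((u + L₀ + v : ℕ) : ℝ) ^ θ
        ≤ 1 / escapeDeficit ω₂ lam β γ T (u + L₀ + v))
    (hNs : max N₂ 2 ≤ Ns) (hL : L₀ ≤ Ns)
    (hgood : gradedChainFactor θ * C * ((Ns + L₀ : ℕ) : ℝ) ^ θ + c ≤ 1 / escapeDeficit ω₂ lam β γ T Ns) :
    ∃ C₁ : ℝ, ∃ N₀ : ℕ, ∀ N : ℕ, N₀ ≤ N → escapeDeficit ω₂ lam β γ T N ≤ C₁ / (N : ℝ) := by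
  have hpos : ∀ N : ℕ, 2 ≤ N → 0 < escapeDeficit ω₂ lam β γ T N := fun N hN =>
    JunctionDefectGrading.escapeDeficit_pos hω hl hβ hγ hT hN
  have hJ' : ∀ u v : ℕ, max N₂ 2 ≤ u → max N₂ 2 ≤ v →
      1 / escapeDeficit ω₂ lam β γ T u + 1 / escapeDeficit ω₂ lam β γ T v - C * ((u + L₀ + v : ℕ) : ℝ) ^ θ
        ≤ 1 / escapeDeficit ω₂ lam β γ T (u + L₀ + v) := fun u v hu hv =>
    hJ u v (le_trans (le_max_left _ _) hu) (le_trans (le_max_left _ _) hv)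
  have hr0 : ∀ n : ℕ, max N₂ 2 ≤ n → 0 ≤ 1 / escapeDeficit ω₂ lam β γ T n := fun n hn =>
    (one_div_pos.2 (hpos n (le_trans (le_max_right _ _) hn))).le
  obtain ⟨a, ha, N₀, hlin⟩ := linear_of_bufferedJunctionPow_of_goodScale (r := fun N => 1 / escapeDeficit ω₂ lam β γ T N)
    hθ0 hθ hC hc hr0 hJ' hNs (le_trans (by omega) hNs) hL hgood
  refine ⟨1 / a, max N₀ 2, fun N hN => ?_⟩
  have hE := hpos N (le_trans (le_max_right _ _) hN)
  have hNpos : (0 : ℝ) < N := by exact_mod_cast lt_of_lt_of_le (by norm_num) (le_trans (le_max_right N₀ 2) hN)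
  have h : a * (N : ℝ) ≤ 1 / escapeDeficit ω₂ lam β γ T N := hlin N (le_trans (le_max_left _ _) hN)
  have h' : a * (N : ℝ) * escapeDeficit ω₂ lam β γ T N ≤ 1 := (le_div_iff₀ hE).mp h
  rw [div_div, le_div_iff₀ (mul_pos ha hNpos)]
  calc escapeDeficit ω₂ lam β γ T N * (a * N) = a * (N : ℝ) * escapeDeficit ω₂ lam β γ T N := by ring
    _ ≤ 1 := h'

/-- **THE GRADED NODE: `BufferedJunctionLawPow θ → EscapeInfZeroPow θ → BoundedResponse`, `0 ≤ θ < 1`** — same exponent on both sides, the floor a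
LIMINF (one good scale per temperature: `N⋆ ≥ max N₂ 2 L₀ 1` with `N⋆^θ E_{N⋆} ≤ 1/(2^θ K_θ C + 1)`). [kernel · frame] -/
theorem boundedResponse_of_bufferedJunctionLawPow_of_escapeInfZeroPow {θ : ℝ} (hθ0 : 0 ≤ θ) (hθ : θ < 1)
    (hB : BufferedJunctionLawPow θ) (hI : EscapeInfZeroPow θ) : BoundedResponse := by
  refine ohmicFloor_iff_boundedResponse.1 fun ω₂ lam β γ hω hl hβ hγ T hT => ?_
  obtain ⟨C, hC, L₀, N₂, hJ⟩ := hB ω₂ lam β γ hω hl hβ hγ T hT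
  have hK : 0 ≤ gradedChainFactor θ := by
    have h1 : (2 : ℝ) ^ θ < (2 : ℝ) ^ (1 : ℝ) := Real.rpow_lt_rpow_of_exponent_lt (by norm_num) hθ
    rw [Real.rpow_one] at h1
    unfold gradedChainFactor
    exact div_nonneg (by positivity) (by linarith)
  have hε : (0 : ℝ) < 1 / ((2 : ℝ) ^ θ * gradedChainFactor θ * C + 1) := by positivity
  obtain ⟨Ns, hNs, hle⟩ := hI ω₂ lam β γ hω hl hβ hγ T hT _ hε (max (max N₂ 2) (max L₀ 1))
  have hNs2 : max N₂ 2 ≤ Ns := le_trans (le_max_left _ _) hNs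
  have hL : L₀ ≤ Ns := le_trans (le_trans (le_max_left L₀ 1) (le_max_right _ _)) hNs
  have hNs1 : (1 : ℝ) ≤ Ns := by exact_mod_cast le_trans (le_trans (le_max_right L₀ 1) (le_max_right _ _)) hNs
  have hE : 0 < escapeDeficit ω₂ lam β γ T Ns :=
    JunctionDefectGrading.escapeDeficit_pos hω hl hβ hγ hT (le_trans (le_max_right _ _) hNs2)
  have hNθ1 : 1 ≤ (Ns : ℝ) ^ θ := Real.one_le_rpow hNs1 hθ0
  -- `(N⋆+L₀)^θ ≤ (2N⋆)^θ = 2^θ N⋆^θ`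
  have hsum : ((Ns + L₀ : ℕ) : ℝ) ^ θ ≤ (2 : ℝ) ^ θ * (Ns : ℝ) ^ θ := by
    have hle2 : ((Ns + L₀ : ℕ) : ℝ) ≤ 2 * (Ns : ℝ) := by
      have : Ns + L₀ ≤ 2 * Ns := by omega
      exact_mod_cast this
    calc ((Ns + L₀ : ℕ) : ℝ) ^ θ ≤ (2 * (Ns : ℝ)) ^ θ := Real.rpow_le_rpow (by positivity) hle2 hθ0
      _ = (2 : ℝ) ^ θ * (Ns : ℝ) ^ θ := Real.mul_rpow (by norm_num) (by positivity)
  -- `1/E_{N⋆} ≥ N⋆^θ·(2^θ K C + 1) ≥ K C (N⋆+L₀)^θ + 1`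
  have hinv : (Ns : ℝ) ^ θ * ((2 : ℝ) ^ θ * gradedChainFactor θ * C + 1) ≤ 1 / escapeDeficit ω₂ lam β γ T Ns := by
    rw [le_div_iff₀ hE]
    have h := (le_div_iff₀ (show (0 : ℝ) < (2 : ℝ) ^ θ * gradedChainFactor θ * C + 1 by positivity)).1 hle
    nlinarith
  have hgood : gradedChainFactor θ * C * ((Ns + L₀ : ℕ) : ℝ) ^ θ + 1 ≤ 1 / escapeDeficit ω₂ lam β γ T Ns := by
    have h1 : gradedChainFactor θ * C * ((Ns + L₀ : ℕ) : ℝ) ^ θ ≤ gradedChainFactor θ * C * ((2 : ℝ) ^ θ * (Ns : ℝ) ^ θ) :=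
      mul_le_mul_of_nonneg_left hsum (mul_nonneg hK hC)
    have hKC : 0 ≤ (2 : ℝ) ^ θ * gradedChainFactor θ * C := by positivity
    nlinarith
  exact escapeFloor_one_of_bufferedJunctionPowAt_of_goodScale hω hl hβ hγ hT hθ0 hθ hC one_pos hJ hNs2 hL hgood

/-- **`JunctionLaw θ → EscapeInfZeroPow θ → BoundedResponse`** (`0 ≤ θ < 1`): the exact-junction law of file (2) with the SAME-exponent liminf
floor — compare the tree's `SplitLaw θ ∧ ExponentFloor s`, `s > θ`. [kernel · frame] -/
theorem boundedResponse_of_junctionLaw_of_escapeInfZeroPow {θ : ℝ} (hθ0 : 0 ≤ θ) (hθ : θ < 1)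
    (hJ : JunctionDefectGrading.JunctionLaw θ) (hI : EscapeInfZeroPow θ) : BoundedResponse :=
  boundedResponse_of_bufferedJunctionLawPow_of_escapeInfZeroPow hθ0 hθ (bufferedJunctionLawPow_of_junctionLaw hJ) hI

/-- **`BufferedJunctionLawPow θ → ExponentFloor s → BoundedResponse`** for `0 ≤ θ < s` (`θ < 1`) — the free-split analogue of the tree node
`boundedResponse_of_splitLaw_of_exponentFloor`. [kernel · frame] -/
theorem boundedResponse_of_bufferedJunctionLawPow_of_exponentFloor {θ s : ℝ} (hθ0 : 0 ≤ θ) (hθ : θ < 1) (hθs : θ < s)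
    (hB : BufferedJunctionLawPow θ) (hF : ExponentFloor s) : BoundedResponse :=
  boundedResponse_of_bufferedJunctionLawPow_of_escapeInfZeroPow hθ0 hθ hB (escapeInfZeroPow_of_exponentFloor hθs hF)

end EscapeGrading

end Summit.AtomisticToContinuum.FouriersLaw.Theorems.SubdiffusiveBondHeat

end
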